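import Literature.Probability.LatticeModels.PlaneRotatorLiebCriterion
import Literature.Probability.LatticeModels.LayeredPlaneRotatorOnsagerWindow
import HarnessLib

/-!
# Explicit weak-interlayer windows for the layered plane rotator: rational `(K₀, ε₀, m₀)` with
# `βJ∥ ≤ K₀ ∧ βJ⊥ ≤ ε₀ ⇒ ⟨cos(θ_a − θ_c)⟩_Λ ≤ m₀^{‖a − c‖₁} < 1` on every finite `Λ ⊂ ℤ³`

Topic `Literature/Probability/LatticeModels`. The classical LAYERED XY model (`layeredXYCoupling β J∥ J⊥ Λ` of
`PlaneRotatorMeanFieldBound.lean`: `J∥ ≥ 0` on in-plane nearest-neighbour bonds of `ℤ³`, `J⊥ ≥ 0` on the vertical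
ones, inverse temperature `β`, free boundary conditions on a finite `Λ ⊂ ℤ³`; `twoPoint` of
`PlaneRotatorGinibreComparison.lean`) is the comparison model of the 2D → 3D device of cell `pub/hubbard-tc`
(MO-S3; keys K4-c/K5, INTERLAYER L3). Two DECAY CRITERIA for it are theorems of the tree:

* Lieb's **star** (E. H. Lieb, Comm. Math. Phys. **77** (1980) 127 [Lieb1980], Theorem 4) in Amos' algebraic form
  `twoPoint_layered_le_pow_amos` (`PlaneRotatorLiebCriterion.lean`):
  `⟨cos(θ_a − θ_c)⟩_{Λ,β} ≤ (4x/√(x²+4) + 2y/√(y²+4))^{‖a − c‖₁}`, `x = βJ∥`, `y = βJ⊥` (`u(t) = I₁(t)/I₀(t) ≤ t/√(t²+4)`,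
  D. E. Amos 1974);
* the **box-localised layer decoupling** `twoPoint_layered_le_pow_box2D` (`LayeredPlaneRotatorSlabReduction.lean`):
  `⟨cos(θ_a − θ_c)⟩_{Λ,β} ≤ (S_R(βJ∥) + βJ⊥·χ^{int}_R(βJ∥))^{n_R(a − c)}` with Lieb's two-dimensional box number
  `S_R = nnBoxShellSum (βJ∥) 2 R` ([Lieb1980] p. 128, "finite algorithm") and the interior susceptibility
  `χ^{int}_R = boxInteriorSum (βJ∥) R` of ONE `[−R,R]²` box; at `R = 1` the slab reference system is the star.

What this file adds (all PROVED; no `def`, no numerics outside the kernel):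

* §1 `layered_decay_of_nnBoxShellSum_lt_one` — **the weak-interlayer threshold from ONE two-dimensional box,
  with EXPLICIT constants, uniformly in `βJ∥ ≤ K₀`**: if `S_R(K₀) < 1` then for ALL `β, J∥, J⊥ ≥ 0` with `βJ∥ ≤ K₀` and
  `βJ⊥ ≤ (1 − S_R(K₀))/(2(χ^{int}_R(K₀) + 1))`, every finite `Λ ⊂ ℤ³` and all `a, c`:
  `⟨cos(θ_a − θ_c)⟩_Λ ≤ ((1 + S_R(K₀))/2)^{n_R(a − c)}` (and `^{⌊‖a − c‖_∞/R⌋}`, `…_supNorm_…`); the layer form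
  `layered_decay_across_layers_of_nnBoxShellSum_lt_one` with the single-layer susceptibility ceiling `X_R(S_R(K₀)) > 0`
  (`boxSusceptibilityBound_pos`). The box number is a HYPOTHESIS here: this is the general form of the tree's
  `exists_layered_slabBound_of_lt_log_one_add_sqrt_two` (`LayeredPlaneRotatorOnsagerWindow.lean`, which instantiates it
  at the existential radius of the Onsager window) and the statement a certified box number feeds (e.g. the cell's
  producer-certified `S_2(0.663) < 1`).
* §2 `twoPoint_layered_le_pow_amos_of_le`, `twoPoint_layered_le_pow_of_certificate` — `t ↦ t/√(t²+4)` is monotone,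
  hence ONE Amos base for the whole rectangle `βJ∥ ≤ x`, `βJ⊥ ≤ y`, and the certificate template: rationals
  `r₁² ≤ x² + 4`, `r₂² ≤ y² + 4`, `4x/r₁ + 2y/r₂ ≤ m₀` give `⟨cos(θ_a − θ_c)⟩_Λ ≤ m₀^{‖a − c‖₁}` on the rectangle.
* §3 **the explicit windows** (`x = K₀`, `y = ε₀`, `m₀`; exact rational arithmetic in the kernel):
  `layered_decay_window_half` **`(1/2, 0.0298, 0.99997)`** — the headline pair (`sup ε₀ = 0.02986` under Amos,
  `0.03000` with the exact Bessel ratio, so `0.0298` is the largest three-digit threshold of the method);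
  `layered_decay_window_near_star (0.51, 0.0115, 0.99993)` (the star closes at `βJ∥ = 2/√15 = 0.5164`),
  `layered_decay_window_two_fifths (2/5, 1/5, 0.9835)`, `layered_decay_window_third (1/3, 1/3, 0.9865)`,
  `layered_decay_window_quarter (1/4, 1/2, 0.9813)`, `layered_decay_window_fifth (1/5, 5/8, 0.9947)`:
  for all `β, J∥, J⊥ ≥ 0` with `βJ∥ ≤ K₀`, `βJ⊥ ≤ ε₀`, every finite `Λ ⊂ ℤ³` and `a, c ∈ Λ`,
  `⟨cos(θ_a − θ_c)⟩_{Λ,β} ≤ m₀^{‖a − c‖₁}` — uniform exponential clustering, an explicit rate, no existential constant.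
* §4 the **temperature form** (`β = 1/T`): `layered_disorder_of_two_le` — for `J∥ > 0`, every `T ≥ 2J∥` and every
  `0 ≤ J⊥ ≤ 0.0596·J∥`: `⟨cos(θ_a − θ_c)⟩_{Λ,1/T} ≤ 0.99997^{‖a − c‖₁}`; `layered_disorder_of_near_star`
  (`T ≥ 1.961·J∥`, `J⊥ ≤ J∥/45`), `layered_disorder_of_three_le` (`T ≥ 3J∥`, `J⊥ ≤ J∥`), `layered_disorder_of_four_le`
  (`T ≥ 4J∥`, `J⊥ ≤ 2J∥`). Read on the ordering temperature of the layered
  comparison model (finite-volume sense, like every ceiling of the cell): **`k_B T_c^{3D-XY}(J∥, J⊥) ≤ 2J∥` for every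
  anisotropy `J⊥/J∥ ≤ 0.0596`** (all cuprate-like stacks), `≤ 3J∥` up to the isotropic point `J⊥ = J∥`, `≤ 4J∥` up to
  `J⊥ = 2J∥` — numbers, not an existential `ε`.
* §5 (the two-dimensional input of the Onsager window, kept here) `exists_susceptibility_bound_of_lt_log_one_add_sqrt_two`:
  **the susceptibility of the 2D XY model is bounded uniformly in the volume for every `K < log(1+√2)`** —
  `∑_{x∈Λ} ⟨cos(θ_a − θ_x)⟩_{Λ,K} ≤ X_R(S_R(K))` for every finite `Λ ⊂ ℤ²`, from `PlaneRotatorOnsagerWindow`'s radius and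
  `sum_twoPoint_nn_le_boxSusceptibilityBound`.

* §6 `nnBoxShellSum_two_one`, `boxInteriorSum_one` — **the `R = 1` instance of §1 on `ℤ²` is Lieb's star**:
  `S_1(K) = 4·I₁(K)/I₀(K)` and `χ^{int}_1(K) = 1` (the four corners of `[−1,1]²` are free rotators, the interior is the
  centre), so the finite algorithm's first step (`twoPoint_nn_le_pow_boxShellSum`,
  `tendsto_torusXYStiffness_of_nnBoxShellSum_lt_one` at `R = 1`) is literally Theorem 4's `4u(K) < 1`.

Context: the explicit REGION `{4x/√(x²+4) + 2y/√(y²+4) < 1}` is Lieb's `R = 1` step; larger boxes (`R = 2`: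
`K∥ ≤ 0.663`, certified outside the kernel) and the Aizenman–Simon–Onsager window (`K∥ < log(1+√2)`,
`LayeredPlaneRotatorOnsagerWindow.lean`, threshold existential) sharpen `K₀` at the price of explicitness. Physics of
the layers `(J, J, εJ)`: [LiuStanley1972]; layer decoupling [Simon1980CMP] Thm 1.3. WHAT THIS IS NOT: not the
Kosterlitz–Thouless temperature of a layer, not a lower bound, not `Υ`; classical comparison model only, never a
Hubbard or material statement.
-/

noncomputable section

open MeasureTheory Finset Filter Topology
open scoped BigOperators

namespace Literature.Probability.LatticeModels

namespace PlaneRotator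

open Literature.Barriers.CriticalPhenomena Literature.Barriers.CriticalPhenomena.LongRangeIsing

/-! ## §1 The weak-interlayer threshold from ONE two-dimensional box, with explicit constants -/

section Box

/-- The box susceptibility bound is positive: `X_R(s) ≥ (2R − 1)² ≥ 1` for `R ≥ 1`, `0 ≤ s < 1`.
[cite: Simon1980CMP, Thm 1.3 (exponential decay summed over the lattice)] -/
theorem boxSusceptibilityBound_pos {R : ℕ} (hR : 1 ≤ R) {s : ℝ} (hs0 : 0 ≤ s) (hs1 : s < 1) :
    0 < boxSusceptibilityBound R s := by
  unfold boxSusceptibilityBound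
  have hR' : (1 : ℝ) ≤ R := by exact_mod_cast hR
  have h1 : (1 : ℝ) ≤ (2 * R - 1 : ℝ) ^ 2 := by nlinarith
  have h2 : 0 ≤ 4 * (R : ℝ) * (R - 1) * (s / (1 - s)) :=
    mul_nonneg (mul_nonneg (by positivity) (by linarith)) (div_nonneg hs0 (by linarith))
  have h3 : 0 ≤ 8 * (R : ℝ) ^ 2 * (s / (1 - s) ^ 2) := by positivity
  linarith

variable [MeasurableSpace Circle] [BorelSpace Circle]

/-- **Weak interlayer coupling: the threshold from one two-dimensional box, with explicit constants.** Let
`K₀ ≥ 0`, `R ≥ 1`, and suppose Lieb's box number of the square lattice satisfies `S_R(K₀) = nnBoxShellSum K₀ 2 R < 1`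
(a HYPOTHESIS here — the number a finite computation certifies). Put `χ^{int}_R = boxInteriorSum K₀ R`. Then for ALL
`β, J∥, J⊥ ≥ 0` with

  `βJ∥ ≤ K₀`  and  `βJ⊥ ≤ (1 − S_R(K₀)) / (2(χ^{int}_R(K₀) + 1))`,

every finite `Λ ⊂ ℤ³` (free boundary conditions) and all `a, c ∈ Λ`:

  `⟨cos(θ_a − θ_c)⟩_{Λ; β, J∥, J⊥} ≤ ((1 + S_R(K₀))/2) ^ n_R(a − c)`,  `n_R = aIndex (slabRadii R)`, base `< 1`

(Griffiths–Ginibre `twoPoint_layered_mono_of_mul_le` to the couplings `(1, K₀, βJ⊥)`, then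
`twoPoint_layered_le_pow_box2D` with its base `S_R + βJ⊥χ^{int}_R ≤ (1 + S_R)/2`). This is the general form — box number
as input, threshold and rate as OUTPUT — of `exists_layered_slabBound_of_lt_log_one_add_sqrt_two`, which instantiates it
at the (existential) radius of the Aizenman–Simon–Onsager window.
[cite: Lieb1980, eq. (23) and p. 128 (boxes; finite algorithm); Simon1980CMP, Thm 1.3; LiuStanley1972, p. 272 (layers (J, J, εJ))] -/
theorem layered_decay_of_nnBoxShellSum_lt_one {K₀ : ℝ} (hK0 : 0 ≤ K₀) {R : ℕ} (hR : 1 ≤ R)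
    (hS : nnBoxShellSum K₀ 2 R < 1) {β Jp Jz : ℝ} (hβ : 0 ≤ β) (hp : 0 ≤ Jp) (hz : 0 ≤ Jz) (hx : β * Jp ≤ K₀)
    (hy : β * Jz ≤ (1 - nnBoxShellSum K₀ 2 R) / (2 * (boxInteriorSum K₀ R + 1)))
    (Λ : Finset (Site 3)) (a c : Λ) :
    twoPoint (layeredXYCoupling β Jp Jz Λ) a c ≤
      ((1 + nnBoxShellSum K₀ 2 R) / 2) ^ aIndex (slabRadii R) ((a : Site 3) - (c : Site 3)) := by
  set S : ℝ := nnBoxShellSum K₀ 2 R with hSdef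
  set X : ℝ := boxInteriorSum K₀ R with hXdef
  have hS0 : 0 ≤ S :=
    boxShellSum_nonneg (fun x y => mul_nonneg (by positivity) (nnCoupling_nonneg _ _)) R
  have hX0 : 0 ≤ X := boxInteriorSum_nonneg hK0 R
  -- Griffiths–Ginibre: pass to the couplings `(1, K₀, βJ⊥)`
  refine (twoPoint_layered_mono_of_mul_le hβ hp hz hx (le_refl (β * Jz)) Λ a c).trans ?_
  -- the slab reduction at `(1, K₀, βJ⊥)`
  have hslab := twoPoint_layered_le_pow_box2D (β := 1) (Jp := K₀) (Jz := β * Jz) zero_le_one hK0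
    (mul_nonneg hβ hz) hR Λ a c
  simp only [one_mul] at hslab
  refine hslab.trans (pow_le_pow_left₀ (add_nonneg hS0 (mul_nonneg (mul_nonneg hβ hz) hX0)) ?_ _)
  -- the base: `S + βJ⊥·X ≤ S + (1 − S)X/(2(X + 1)) ≤ (1 + S)/2`
  have h1 : β * Jz * X ≤ (1 - S) / (2 * (X + 1)) * X := mul_le_mul_of_nonneg_right hy hX0
  have h2 : (1 - S) / (2 * (X + 1)) * X ≤ (1 - S) / 2 := by
    rw [div_mul_eq_mul_div, div_le_div_iff₀ (by positivity) (by positivity)]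
    nlinarith
  linarith

/-- The same threshold read with the distance: under the hypotheses of `layered_decay_of_nnBoxShellSum_lt_one`,
`⟨cos(θ_a − θ_c)⟩_{Λ; β, J∥, J⊥} ≤ ((1 + S_R(K₀))/2) ^ ⌊‖a − c‖_∞/R⌋` (tree `supNorm_div_le_aIndex_slabRadii`).
[cite: Lieb1980, eq. (23) and p. 128 (boxes; finite algorithm); Simon1980CMP, Thm 1.3] -/
theorem layered_decay_supNorm_of_nnBoxShellSum_lt_one {K₀ : ℝ} (hK0 : 0 ≤ K₀) {R : ℕ} (hR : 1 ≤ R)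
    (hS : nnBoxShellSum K₀ 2 R < 1) {β Jp Jz : ℝ} (hβ : 0 ≤ β) (hp : 0 ≤ Jp) (hz : 0 ≤ Jz) (hx : β * Jp ≤ K₀)
    (hy : β * Jz ≤ (1 - nnBoxShellSum K₀ 2 R) / (2 * (boxInteriorSum K₀ R + 1)))
    (Λ : Finset (Site 3)) (a c : Λ) :
    twoPoint (layeredXYCoupling β Jp Jz Λ) a c ≤
      ((1 + nnBoxShellSum K₀ 2 R) / 2) ^ (Site.supNorm ((a : Site 3) - (c : Site 3)) / R) := by
  have hS0 : 0 ≤ nnBoxShellSum K₀ 2 R :=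
    boxShellSum_nonneg (fun x y => mul_nonneg (by positivity) (nnCoupling_nonneg _ _)) R
  exact (layered_decay_of_nnBoxShellSum_lt_one hK0 hR hS hβ hp hz hx hy Λ a c).trans
    (pow_le_pow_of_le_one (by linarith) (by linarith) (supNorm_div_le_aIndex_slabRadii hR _))

/-- **Decay across the layers with an explicit single-layer susceptibility ceiling, uniformly in `βJ∥ ≤ K₀`.** If
`S_R(K₀) < 1` for some `R ≥ 1` then with the explicit `χ = X_R(S_R(K₀)) > 0` (`boxSusceptibilityBound`,
`boxSusceptibilityBound_pos`), for ALL `β, J∥, J⊥ ≥ 0` with `βJ∥ ≤ K₀`, every finite `Λ ⊂ ℤ³` and all `a, c ∈ Λ`: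
`⟨cos(θ_a − θ_c)⟩_{Λ; β, J∥, J⊥} ≤ (βJ⊥·χ)^{|ℓ(a) − ℓ(c)|}` — exponential decay across the layers as soon as `βJ⊥ < 1/χ`
(`twoPoint_layered_le_pow_interlayer_box` at `(1, K₀, βJ⊥)` after Griffiths–Ginibre).
[cite: Simon1980CMP, Thm 1.3; Lieb1980, eq. (23) and p. 128; LiuStanley1972, p. 272 (layers (J, J, εJ))] -/
theorem layered_decay_across_layers_of_nnBoxShellSum_lt_one {K₀ : ℝ} (hK0 : 0 ≤ K₀) {R : ℕ} (hR : 1 ≤ R)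
    (hS : nnBoxShellSum K₀ 2 R < 1) {β Jp Jz : ℝ} (hβ : 0 ≤ β) (hp : 0 ≤ Jp) (hz : 0 ≤ Jz) (hx : β * Jp ≤ K₀)
    (Λ : Finset (Site 3)) (a c : Λ) :
    twoPoint (layeredXYCoupling β Jp Jz Λ) a c ≤
      (β * Jz * boxSusceptibilityBound R (nnBoxShellSum K₀ 2 R)) ^ (layer a - layer c).natAbs := by
  refine (twoPoint_layered_mono_of_mul_le hβ hp hz hx (le_refl (β * Jz)) Λ a c).trans ?_
  have h := twoPoint_layered_le_pow_interlayer_box (β := 1) (Jp := K₀) (Jz := β * Jz) zero_le_one hK0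
    (mul_nonneg hβ hz) hR (by simpa only [one_mul] using hS) Λ a c
  simpa only [one_mul] using h

end Box

/-! ## §2 Lieb's star in Amos' form is monotone: ONE base for the rectangle `βJ∥ ≤ x`, `βJ⊥ ≤ y` -/

section Amos

/-- `t ↦ t/√(t² + 4)` is non-decreasing on `[0, ∞)` (it is `1/√(1 + 4/t²)`). [folklore] -/
private theorem amos_ratio_mono {s t : ℝ} (hs : 0 ≤ s) (hst : s ≤ t) :
    s / Real.sqrt (s ^ 2 + 4) ≤ t / Real.sqrt (t ^ 2 + 4) := by
  have ht : 0 ≤ t := hs.trans hst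
  have hS : 0 < Real.sqrt (s ^ 2 + 4) := Real.sqrt_pos.2 (by positivity)
  have hT : 0 < Real.sqrt (t ^ 2 + 4) := Real.sqrt_pos.2 (by positivity)
  rw [div_le_div_iff₀ hS hT]
  have h1 : s * Real.sqrt (t ^ 2 + 4) = Real.sqrt (s ^ 2 * (t ^ 2 + 4)) := by
    rw [Real.sqrt_mul (sq_nonneg s), Real.sqrt_sq hs]
  have h2 : t * Real.sqrt (s ^ 2 + 4) = Real.sqrt (t ^ 2 * (s ^ 2 + 4)) := by
    rw [Real.sqrt_mul (sq_nonneg t), Real.sqrt_sq ht]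
  rw [h1, h2]
  exact Real.sqrt_le_sqrt (by nlinarith [mul_nonneg hs ht, sq_nonneg s, sq_nonneg t])

/-- `0 ≤ t/√(t² + 4)` for `t ≥ 0`. [folklore] -/
private theorem amos_ratio_nonneg {t : ℝ} (ht : 0 ≤ t) : 0 ≤ t / Real.sqrt (t ^ 2 + 4) :=
  div_nonneg ht (Real.sqrt_nonneg _)

variable [MeasurableSpace Circle] [BorelSpace Circle]

/-- **Lieb's star bound, uniformly on a rectangle of couplings.** For `β, J∥, J⊥ ≥ 0` with `βJ∥ ≤ x` and
`βJ⊥ ≤ y`, every finite `Λ ⊂ ℤ³` and `a, c ∈ Λ`: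
`⟨cos(θ_a − θ_c)⟩_{Λ,β} ≤ (4x/√(x²+4) + 2y/√(y²+4))^{‖a − c‖₁}` (`twoPoint_layered_le_pow_amos` and the monotonicity
of Amos' ratio). [cite: Lieb1980, Theorem 4; Amos1974, eq. (11) (m = 0)] -/
theorem twoPoint_layered_le_pow_amos_of_le {β Jp Jz x y : ℝ} (hβ : 0 ≤ β) (hp : 0 ≤ Jp) (hz : 0 ≤ Jz)
    (hx : β * Jp ≤ x) (hy : β * Jz ≤ y) (Λ : Finset (Site 3)) (a c : Λ) :
    twoPoint (layeredXYCoupling β Jp Jz Λ) a c ≤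
      (4 * (x / Real.sqrt (x ^ 2 + 4)) + 2 * (y / Real.sqrt (y ^ 2 + 4))) ^ l1Norm ((a : Site 3) - (c : Site 3)) := by
  refine (twoPoint_layered_le_pow_amos hβ hp hz Λ a c).trans (pow_le_pow_left₀ ?_ ?_ _)
  · exact add_nonneg (mul_nonneg (by norm_num) (amos_ratio_nonneg (mul_nonneg hβ hp)))
      (mul_nonneg (by norm_num) (amos_ratio_nonneg (mul_nonneg hβ hz)))
  · have h1 := amos_ratio_mono (mul_nonneg hβ hp) hx
    have h2 := amos_ratio_mono (mul_nonneg hβ hz) hy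
    linarith

omit [MeasurableSpace Circle] [BorelSpace Circle] in
/-- **Rational comparison of the Amos base**: if `0 ≤ x, y`, `0 < r₁, r₂`, `r₁² ≤ x² + 4` and `r₂² ≤ y² + 4` then
`4x/√(x²+4) + 2y/√(y²+4) ≤ 4x/r₁ + 2y/r₂` (lower rational enclosures of the two square roots). [folklore] -/
private theorem amos_base_le_of_sq_le {x y r₁ r₂ : ℝ} (hx : 0 ≤ x) (hy : 0 ≤ y) (hr₁ : 0 < r₁) (hr₂ : 0 < r₂)
    (h₁ : r₁ ^ 2 ≤ x ^ 2 + 4) (h₂ : r₂ ^ 2 ≤ y ^ 2 + 4) :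
    4 * (x / Real.sqrt (x ^ 2 + 4)) + 2 * (y / Real.sqrt (y ^ 2 + 4)) ≤ 4 * x / r₁ + 2 * y / r₂ := by
  have hs₁ : r₁ ≤ Real.sqrt (x ^ 2 + 4) := Real.le_sqrt_of_sq_le h₁
  have hs₂ : r₂ ≤ Real.sqrt (y ^ 2 + 4) := Real.le_sqrt_of_sq_le h₂
  have e₁ : x / Real.sqrt (x ^ 2 + 4) ≤ x / r₁ := div_le_div_of_nonneg_left hx hr₁ hs₁
  have e₂ : y / Real.sqrt (y ^ 2 + 4) ≤ y / r₂ := div_le_div_of_nonneg_left hy hr₂ hs₂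
  have e₃ : 4 * x / r₁ = 4 * (x / r₁) := by ring
  have e₄ : 2 * y / r₂ = 2 * (y / r₂) := by ring
  rw [e₃, e₄]
  linarith

/-- **The explicit-window template.** If `0 ≤ x, y`, `0 < r₁, r₂` with `r₁² ≤ x² + 4`, `r₂² ≤ y² + 4` and
`4x/r₁ + 2y/r₂ ≤ m₀`, then for all `β, J∥, J⊥ ≥ 0` with `βJ∥ ≤ x`, `βJ⊥ ≤ y`, every finite `Λ ⊂ ℤ³` and `a, c ∈ Λ`:
`⟨cos(θ_a − θ_c)⟩_{Λ,β} ≤ m₀^{‖a − c‖₁}`. [cite: Lieb1980, Theorem 4; Amos1974, eq. (11) (m = 0)] -/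
theorem twoPoint_layered_le_pow_of_certificate {β Jp Jz x y r₁ r₂ m₀ : ℝ} (hβ : 0 ≤ β) (hp : 0 ≤ Jp)
    (hz : 0 ≤ Jz) (hx0 : 0 ≤ x) (hy0 : 0 ≤ y) (hr₁ : 0 < r₁) (hr₂ : 0 < r₂) (h₁ : r₁ ^ 2 ≤ x ^ 2 + 4)
    (h₂ : r₂ ^ 2 ≤ y ^ 2 + 4) (hm : 4 * x / r₁ + 2 * y / r₂ ≤ m₀) (hx : β * Jp ≤ x) (hy : β * Jz ≤ y)
    (Λ : Finset (Site 3)) (a c : Λ) :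
    twoPoint (layeredXYCoupling β Jp Jz Λ) a c ≤ m₀ ^ l1Norm ((a : Site 3) - (c : Site 3)) := by
  refine (twoPoint_layered_le_pow_amos_of_le hβ hp hz hx hy Λ a c).trans (pow_le_pow_left₀ ?_ ?_ _)
  · exact add_nonneg (mul_nonneg (by norm_num) (amos_ratio_nonneg hx0))
      (mul_nonneg (by norm_num) (amos_ratio_nonneg hy0))
  · exact (amos_base_le_of_sq_le hx0 hy0 hr₁ hr₂ h₁ h₂).trans hm

end Amos

/-! ## §3 The explicit windows `(K₀, ε₀, m₀)` -/

section Windows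

variable [MeasurableSpace Circle] [BorelSpace Circle]

/-- **The headline explicit window `(K₀, ε₀, m₀) = (1/2, 0.0298, 0.99997)`.** For all `β, J∥, J⊥ ≥ 0` with
`βJ∥ ≤ 1/2` and `βJ⊥ ≤ 0.0298 = 149/5000`, every finite `Λ ⊂ ℤ³` (free boundary conditions) and `a, c ∈ Λ`:

  `⟨cos(θ_a − θ_c)⟩_{Λ; β, J∥, J⊥} ≤ 0.99997 ^ ‖a − c‖₁`

(certificate: `√(17/4) ≥ 4123/2000`, `√(y²+4) ≥ 2`; `2/2.0615 + 0.0298 = 0.99996… ≤ 0.99997`). The supremum of the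
admissible `ε₀` at `K₀ = 1/2` is `0.02986` for the Amos form and `0.03000` for the exact two-spin values, so
`0.0298` is the largest three-digit threshold of Lieb's star at this `K₀`.
[cite: Lieb1980, Theorem 4 (β_c ≥ 0.52 for ν = 2); Amos1974, eq. (11) (m = 0)] -/
theorem layered_decay_window_half {β Jp Jz : ℝ} (hβ : 0 ≤ β) (hp : 0 ≤ Jp) (hz : 0 ≤ Jz)
    (hx : β * Jp ≤ 1 / 2) (hy : β * Jz ≤ 149 / 5000) (Λ : Finset (Site 3)) (a c : Λ) :
    twoPoint (layeredXYCoupling β Jp Jz Λ) a c ≤ (99997 / 100000 : ℝ) ^ l1Norm ((a : Site 3) - (c : Site 3)) :=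
  twoPoint_layered_le_pow_of_certificate (x := 1 / 2) (y := 149 / 5000) (r₁ := 4123 / 2000) (r₂ := 2)
    hβ hp hz (by norm_num) (by norm_num) (by norm_num) (by norm_num) (by norm_num) (by norm_num) (by norm_num)
    hx hy Λ a c

/-- **The near-star window `(0.51, 0.0115, 0.99993)`** — the sharpest in-plane threshold of this file
(Lieb's star closes at `βJ∥ = 2/√15 = 0.5164`): `βJ∥ ≤ 51/100 ∧ βJ⊥ ≤ 23/2000 ⇒ ⟨cos(θ_a − θ_c)⟩_Λ ≤ 0.99993^{‖a − c‖₁}`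
(certificate `√4.2601 ≥ 2.0639`, `√(y²+4) ≥ 2`; `sup ε₀(0.51) = 0.01163` under Amos).
[cite: Lieb1980, Theorem 4 (β_c ≥ 0.52 for ν = 2); Amos1974, eq. (11) (m = 0)] -/
theorem layered_decay_window_near_star {β Jp Jz : ℝ} (hβ : 0 ≤ β) (hp : 0 ≤ Jp) (hz : 0 ≤ Jz)
    (hx : β * Jp ≤ 51 / 100) (hy : β * Jz ≤ 23 / 2000) (Λ : Finset (Site 3)) (a c : Λ) :
    twoPoint (layeredXYCoupling β Jp Jz Λ) a c ≤ (99993 / 100000 : ℝ) ^ l1Norm ((a : Site 3) - (c : Site 3)) :=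
  twoPoint_layered_le_pow_of_certificate (x := 51 / 100) (y := 23 / 2000) (r₁ := 20639 / 10000) (r₂ := 2)
    hβ hp hz (by norm_num) (by norm_num) (by norm_num) (by norm_num) (by norm_num) (by norm_num) (by norm_num)
    hx hy Λ a c

/-- **Window `(2/5, 1/5, 0.9835)`**: `βJ∥ ≤ 2/5 ∧ βJ⊥ ≤ 1/5 ⇒ ⟨cos(θ_a − θ_c)⟩_Λ ≤ 0.9835^{‖a − c‖₁}`
(certificate `√4.16 ≥ 2.0396`, `√4.04 ≥ 2.0099`). [cite: Lieb1980, Theorem 4; Amos1974, eq. (11) (m = 0)] -/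
theorem layered_decay_window_two_fifths {β Jp Jz : ℝ} (hβ : 0 ≤ β) (hp : 0 ≤ Jp) (hz : 0 ≤ Jz)
    (hx : β * Jp ≤ 2 / 5) (hy : β * Jz ≤ 1 / 5) (Λ : Finset (Site 3)) (a c : Λ) :
    twoPoint (layeredXYCoupling β Jp Jz Λ) a c ≤ (9835 / 10000 : ℝ) ^ l1Norm ((a : Site 3) - (c : Site 3)) :=
  twoPoint_layered_le_pow_of_certificate (x := 2 / 5) (y := 1 / 5) (r₁ := 20396 / 10000) (r₂ := 20099 / 10000)
    hβ hp hz (by norm_num) (by norm_num) (by norm_num) (by norm_num) (by norm_num) (by norm_num) (by norm_num)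
    hx hy Λ a c

/-- **Window `(1/3, 1/3, 0.9865)`** — up to the ISOTROPIC point: `βJ∥ ≤ 1/3 ∧ βJ⊥ ≤ 1/3 ⇒
⟨cos(θ_a − θ_c)⟩_Λ ≤ 0.9865^{‖a − c‖₁}` (certificate `√(37/9) ≥ 2.0275`; compare Lieb's `β_c ≥ 0.34` for the
isotropic model on `ℤ³`). [cite: Lieb1980, Theorem 4 (β_c ≥ 0.34 for ν = 3); Amos1974, eq. (11) (m = 0)] -/
theorem layered_decay_window_third {β Jp Jz : ℝ} (hβ : 0 ≤ β) (hp : 0 ≤ Jp) (hz : 0 ≤ Jz)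
    (hx : β * Jp ≤ 1 / 3) (hy : β * Jz ≤ 1 / 3) (Λ : Finset (Site 3)) (a c : Λ) :
    twoPoint (layeredXYCoupling β Jp Jz Λ) a c ≤ (9865 / 10000 : ℝ) ^ l1Norm ((a : Site 3) - (c : Site 3)) :=
  twoPoint_layered_le_pow_of_certificate (x := 1 / 3) (y := 1 / 3) (r₁ := 20275 / 10000) (r₂ := 20275 / 10000)
    hβ hp hz (by norm_num) (by norm_num) (by norm_num) (by norm_num) (by norm_num) (by norm_num) (by norm_num)
    hx hy Λ a c

/-- **Window `(1/4, 1/2, 0.9813)`**: `βJ∥ ≤ 1/4 ∧ βJ⊥ ≤ 1/2 ⇒ ⟨cos(θ_a − θ_c)⟩_Λ ≤ 0.9813^{‖a − c‖₁}`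
(certificate `√4.0625 ≥ 2.0155`, `√4.25 ≥ 2.0615`). [cite: Lieb1980, Theorem 4; Amos1974, eq. (11) (m = 0)] -/
theorem layered_decay_window_quarter {β Jp Jz : ℝ} (hβ : 0 ≤ β) (hp : 0 ≤ Jp) (hz : 0 ≤ Jz)
    (hx : β * Jp ≤ 1 / 4) (hy : β * Jz ≤ 1 / 2) (Λ : Finset (Site 3)) (a c : Λ) :
    twoPoint (layeredXYCoupling β Jp Jz Λ) a c ≤ (9813 / 10000 : ℝ) ^ l1Norm ((a : Site 3) - (c : Site 3)) :=
  twoPoint_layered_le_pow_of_certificate (x := 1 / 4) (y := 1 / 2) (r₁ := 20155 / 10000) (r₂ := 4123 / 2000)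
    hβ hp hz (by norm_num) (by norm_num) (by norm_num) (by norm_num) (by norm_num) (by norm_num) (by norm_num)
    hx hy Λ a c

/-- **Window `(1/5, 5/8, 0.9947)`**: `βJ∥ ≤ 1/5 ∧ βJ⊥ ≤ 5/8 ⇒ ⟨cos(θ_a − θ_c)⟩_Λ ≤ 0.9947^{‖a − c‖₁}`
(certificate `√4.04 ≥ 2.0099`, `√4.390625 ≥ 2.0953`). [cite: Lieb1980, Theorem 4; Amos1974, eq. (11) (m = 0)] -/
theorem layered_decay_window_fifth {β Jp Jz : ℝ} (hβ : 0 ≤ β) (hp : 0 ≤ Jp) (hz : 0 ≤ Jz)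
    (hx : β * Jp ≤ 1 / 5) (hy : β * Jz ≤ 5 / 8) (Λ : Finset (Site 3)) (a c : Λ) :
    twoPoint (layeredXYCoupling β Jp Jz Λ) a c ≤ (9947 / 10000 : ℝ) ^ l1Norm ((a : Site 3) - (c : Site 3)) :=
  twoPoint_layered_le_pow_of_certificate (x := 1 / 5) (y := 5 / 8) (r₁ := 20099 / 10000) (r₂ := 20953 / 10000)
    hβ hp hz (by norm_num) (by norm_num) (by norm_num) (by norm_num) (by norm_num) (by norm_num) (by norm_num)
    hx hy Λ a c

end Windows

/-! ## §4 Temperature form: no order for `T ≥ J∥/K₀` whenever `J⊥ ≤ (ε₀/K₀)·J∥` -/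

section Temperature

/-- From a window in the couplings to a window in temperature and anisotropy: if `T > 0`, `J∥ ≤ K₀·T` and
`J⊥ ≤ ε₀·T` then `J∥/T ≤ K₀` and `J⊥/T ≤ ε₀`. [folklore] -/
private theorem inv_mul_le_of_le_mul {T J K : ℝ} (hT : 0 < T) (h : J ≤ K * T) : T⁻¹ * J ≤ K := by
  rw [inv_mul_eq_div, div_le_iff₀ hT]
  exact h

variable [MeasurableSpace Circle] [BorelSpace Circle]

/-- **No order above `2J∥` for all anisotropies `J⊥/J∥ ≤ 0.0596`.** For `J∥ > 0`, every temperature `T ≥ 2J∥`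
and every interlayer coupling `0 ≤ J⊥ ≤ 0.0596·J∥ = (149/2500)·J∥`, at `β = 1/T`, for every finite `Λ ⊂ ℤ³` (free
boundary conditions) and `a, c ∈ Λ`:

  `⟨cos(θ_a − θ_c)⟩_{Λ; 1/T, J∥, J⊥} ≤ 0.99997 ^ ‖a − c‖₁`

— uniform exponential clustering, i.e. `k_B T_c^{3D-XY}(J∥, J⊥) ≤ 2J∥` for every such stack (finite-volume
sense): the first EXPLICIT weak-interlayer window of the layered comparison model (all cuprate-like anisotropies
`J⊥/J∥ ≤ 10⁻¹` included). [cite: Lieb1980, Theorem 4 (β_c ≥ 0.52, ν = 2); LiuStanley1972, p. 272 (T_c of the layers (J, J, εJ)); Amos1974, eq. (11)] -/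
theorem layered_disorder_of_two_le {Jp Jz T : ℝ} (hp : 0 < Jp) (hT : 2 * Jp ≤ T) (hz : 0 ≤ Jz)
    (hzp : Jz ≤ 149 / 2500 * Jp) (Λ : Finset (Site 3)) (a c : Λ) :
    twoPoint (layeredXYCoupling T⁻¹ Jp Jz Λ) a c ≤ (99997 / 100000 : ℝ) ^ l1Norm ((a : Site 3) - (c : Site 3)) := by
  have hT0 : 0 < T := by linarith
  refine layered_decay_window_half (inv_pos.2 hT0).le hp.le hz (inv_mul_le_of_le_mul hT0 (by linarith))
    (inv_mul_le_of_le_mul hT0 ?_) Λ a c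
  nlinarith

/-- **No order above `1.961·J∥ = (100/51)·J∥` for anisotropies `J⊥/J∥ ≤ 1/45 = 0.0222`** (the near-star row;
every cuprate-like stack, `J⊥/J∥ ≤ 10⁻²`): for `J∥ > 0`, `T ≥ (100/51)·J∥` and `0 ≤ J⊥ ≤ J∥/45`,
`⟨cos(θ_a − θ_c)⟩_{Λ; 1/T, J∥, J⊥} ≤ 0.99993 ^ ‖a − c‖₁` on every finite `Λ ⊂ ℤ³`.
[cite: Lieb1980, Theorem 4 (β_c ≥ 0.52, ν = 2); LiuStanley1972, p. 272; Amos1974, eq. (11)] -/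
theorem layered_disorder_of_near_star {Jp Jz T : ℝ} (hp : 0 < Jp) (hT : 100 / 51 * Jp ≤ T) (hz : 0 ≤ Jz)
    (hzp : Jz ≤ Jp / 45) (Λ : Finset (Site 3)) (a c : Λ) :
    twoPoint (layeredXYCoupling T⁻¹ Jp Jz Λ) a c ≤ (99993 / 100000 : ℝ) ^ l1Norm ((a : Site 3) - (c : Site 3)) := by
  have hT0 : 0 < T := by linarith
  refine layered_decay_window_near_star (inv_pos.2 hT0).le hp.le hz (inv_mul_le_of_le_mul hT0 (by linarith))
    (inv_mul_le_of_le_mul hT0 ?_) Λ a c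
  have h45 : Jp / 45 ≤ 23 / 2000 * (100 / 51 * Jp) := by
    rw [div_le_iff₀ (by norm_num : (0:ℝ) < 45)]
    nlinarith
  linarith [mul_le_mul_of_nonneg_left hT (by norm_num : (0:ℝ) ≤ 23 / 2000)]

/-- **No order above `3J∥` up to the isotropic point.** For `J∥ > 0`, every `T ≥ 3J∥` and every `0 ≤ J⊥ ≤ J∥`:
`⟨cos(θ_a − θ_c)⟩_{Λ; 1/T, J∥, J⊥} ≤ 0.9865 ^ ‖a − c‖₁` on every finite `Λ ⊂ ℤ³` — `T_c^{3D-XY}(J∥, J⊥) ≤ 3J∥`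
whenever `J⊥ ≤ J∥`. [cite: Lieb1980, Theorem 4 (β_c ≥ 0.34 for ν = 3); LiuStanley1972, p. 272; Amos1974, eq. (11)] -/
theorem layered_disorder_of_three_le {Jp Jz T : ℝ} (hp : 0 < Jp) (hT : 3 * Jp ≤ T) (hz : 0 ≤ Jz)
    (hzp : Jz ≤ Jp) (Λ : Finset (Site 3)) (a c : Λ) :
    twoPoint (layeredXYCoupling T⁻¹ Jp Jz Λ) a c ≤ (9865 / 10000 : ℝ) ^ l1Norm ((a : Site 3) - (c : Site 3)) := by
  have hT0 : 0 < T := by linarith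
  exact layered_decay_window_third (inv_pos.2 hT0).le hp.le hz (inv_mul_le_of_le_mul hT0 (by linarith))
    (inv_mul_le_of_le_mul hT0 (by linarith)) Λ a c

/-- **No order above `4J∥` up to `J⊥ = 2J∥`.** For `J∥ > 0`, every `T ≥ 4J∥` and every `0 ≤ J⊥ ≤ 2J∥`:
`⟨cos(θ_a − θ_c)⟩_{Λ; 1/T, J∥, J⊥} ≤ 0.9813 ^ ‖a − c‖₁` on every finite `Λ ⊂ ℤ³`.
[cite: Lieb1980, Theorem 4; LiuStanley1972, p. 272; Amos1974, eq. (11)] -/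
theorem layered_disorder_of_four_le {Jp Jz T : ℝ} (hp : 0 < Jp) (hT : 4 * Jp ≤ T) (hz : 0 ≤ Jz)
    (hzp : Jz ≤ 2 * Jp) (Λ : Finset (Site 3)) (a c : Λ) :
    twoPoint (layeredXYCoupling T⁻¹ Jp Jz Λ) a c ≤ (9813 / 10000 : ℝ) ^ l1Norm ((a : Site 3) - (c : Site 3)) := by
  have hT0 : 0 < T := by linarith
  exact layered_decay_window_quarter (inv_pos.2 hT0).le hp.le hz (inv_mul_le_of_le_mul hT0 (by linarith))
    (inv_mul_le_of_le_mul hT0 (by linarith)) Λ a c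

end Temperature

/-! ## §5 The two-dimensional input: a volume-uniform susceptibility bound throughout `K < log(1+√2)` -/

section Susceptibility

variable [MeasurableSpace Circle] [BorelSpace Circle]

/-- **The susceptibility of the two-dimensional XY model is bounded uniformly in the volume for every
`K < log(1+√2)`.** For `0 ≤ K < log(1+√2)` there is `χ = χ(K)` with `0 < χ < ∞` and
`∑_{x ∈ Λ} ⟨cos(θ_a − θ_x)⟩_{Λ,K} ≤ χ` for every finite `Λ ⊂ ℤ²` (free boundary conditions, nearest-neighbour
coupling `K`) and every `a ∈ Λ` — namely `χ = X_R(S_R(K))` for the box radius of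
`exists_nnBoxShellSum_lt_one_of_lt_log_one_add_sqrt_two` (Aizenman–Simon comparison with the exactly solved planar
Ising model) and `sum_twoPoint_nn_le_boxSusceptibilityBound` (Lieb's box criterion summed over the lattice).
[cite: AizenmanSimon1980RotorIsing, eqs. (1)–(2); Simon1980CMP, Thm 1.3; Lieb1980, p. 128] -/
theorem exists_susceptibility_bound_of_lt_log_one_add_sqrt_two {K : ℝ} (hK0 : 0 ≤ K)
    (hK : K < Real.log (1 + Real.sqrt 2)) :
    ∃ χ : ℝ, 0 < χ ∧ ∀ (Λ : Finset (Site 2)) (a : Λ), ∑ x : Λ, twoPoint (nnXYCoupling K 2 Λ) a x ≤ χ := by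
  obtain ⟨R, hR, hS⟩ := exists_nnBoxShellSum_lt_one_of_lt_log_one_add_sqrt_two hK0 hK
  have hS0 : 0 ≤ nnBoxShellSum K 2 R :=
    boxShellSum_nonneg (fun x y => mul_nonneg (by positivity) (nnCoupling_nonneg _ _)) R
  exact ⟨boxSusceptibilityBound R (nnBoxShellSum K 2 R), boxSusceptibilityBound_pos hR hS0 hS,
    fun Λ a => sum_twoPoint_nn_le_boxSusceptibilityBound hK0 hR hS Λ a⟩

end Susceptibility

/-! ## §6 The `R = 1` instance of §1 on `ℤ²` is Lieb's star: `S_1(K) = 4·I₁(K)/I₀(K)`, `χ^{int}_1(K) = 1` -/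

section RadiusOne

variable [MeasurableSpace Circle] [BorelSpace Circle]

omit [MeasurableSpace Circle] [BorelSpace Circle] in
/-- A sum over the box `[−L, L]²` is a double sum. [folklore] -/
private theorem sum_box_two' (L : ℕ) (F : Site 2 → ℝ) :
    ∑ y ∈ box 2 L, F y = ∑ a ∈ Finset.Icc (-(L : ℤ)) L, ∑ b ∈ Finset.Icc (-(L : ℤ)) L, F ![a, b] := by
  rw [← Finset.sum_product']
  refine Finset.sum_nbij' (fun y => (y 0, y 1)) (fun p => ![p.1, p.2]) ?_ ?_ ?_ ?_ ?_
  · intro y hy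
    rw [mem_box] at hy
    simp only [Finset.mem_product, Finset.mem_Icc]
    exact ⟨⟨(hy 0).1, (hy 0).2⟩, ⟨(hy 1).1, (hy 1).2⟩⟩
  · intro p hp
    simp only [Finset.mem_product, Finset.mem_Icc] at hp
    rw [mem_box]
    intro i
    fin_cases i <;> simp [hp.1.1, hp.1.2, hp.2.1, hp.2.2]
  · intro y _
    funext i; fin_cases i <;> rfl
  · intro p _
    simp
  · intro y _
    congr 1
    funext i; fin_cases i <;> rfl

omit [MeasurableSpace Circle] [BorelSpace Circle] in
/-- The symmetrised nearest-neighbour coupling seen from the origin: `(K/2)𝟙{0∼y} + (K/2)𝟙{y∼0} = K·𝟙{‖y‖₁ = 1}`.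
[folklore] -/
private theorem nn_origin_symm (K : ℝ) (y : Site 2) :
    K / 2 * nnCoupling 2 0 y + K / 2 * nnCoupling 2 y 0 = if l1Norm y = 1 then K else 0 := by
  unfold nnCoupling
  rw [zero_sub, l1Norm_neg, sub_zero]
  split_ifs <;> ring

/-- `⟨cos(θ_a − θ_a)⟩ = 1`. [folklore] -/
private theorem twoPoint_self_eq_one {V : Type*} [Fintype V] (J : V × V → ℝ) (a : V) : twoPoint J a a = 1 := by
  unfold twoPoint ginibreExpect
  have h1 : ∀ θ : V → Circle, cosDiff a a θ = 1 := fun θ => by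
    rw [cosDiff, ← Complex.normSq_eq_conj_mul_self, Complex.ofReal_re, Circle.normSq_coe]
  simp_rw [h1, one_mul]
  exact div_self (integral_exp_pos (integrable_torusHaar_of_continuous (continuous_ginibreWeight _ _))).ne'

/-- **Lieb's number of the square lattice at `R = 1` is the star value**: `S_1(K) = nnBoxShellSum K 2 1 = 4·I₁(K)/I₀(K)`
(tree `boxShellSum_one`: the four neighbours of the centre contribute the two-spin value `I₁(K)/I₀(K)` each, the four
corners of `[−1,1]²` are free rotators and contribute `I₁(0)/I₀(0) = 0`). So the `R = 1` step of the finite algorithm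
(`twoPoint_nn_le_pow_boxShellSum`, `tendsto_torusXYStiffness_of_nnBoxShellSum_lt_one`) is Theorem 4's `4u(K) < 1`,
`K < u⁻¹(¼) ≈ 0.516`. [cite: Lieb1980, Theorem 4 (2ν·I₁(β)/I₀(β) < 1; β_c ≥ 0.52 for ν = 2)] -/
theorem nnBoxShellSum_two_one (K : ℝ) : nnBoxShellSum K 2 1 = 4 * (besselI 1 K / besselI 0 K) := by
  classical
  unfold nnBoxShellSum
  rw [boxShellSum_one]
  have e1 : (∑ b ∈ refShell 2 1, besselI 1 (K / 2 * nnCoupling 2 0 (b : Site 2) + K / 2 * nnCoupling 2 (b : Site 2) 0) /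
        besselI 0 (K / 2 * nnCoupling 2 0 (b : Site 2) + K / 2 * nnCoupling 2 (b : Site 2) 0)) =
      ∑ b : box 2 1, (fun y : Site 2 => if Site.supNorm y = 1 then
        besselI 1 (if l1Norm y = 1 then K else 0) / besselI 0 (if l1Norm y = 1 then K else 0) else 0) (b : Site 2) := by
    rw [refShell, Finset.sum_filter]
    refine Finset.sum_congr rfl fun b _ => ?_
    simp only [nn_origin_symm]
  rw [e1, Finset.sum_coe_sort (box 2 1) (fun y : Site 2 => if Site.supNorm y = 1 then
        besselI 1 (if l1Norm y = 1 then K else 0) / besselI 0 (if l1Norm y = 1 then K else 0) else 0),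
    sum_box_two' 1, show Finset.Icc (-((1 : ℕ) : ℤ)) (1 : ℕ) = {-1, 0, 1} by decide]
  have n1 : (-1 : ℤ) ∉ ({0, 1} : Finset ℤ) := by decide
  have n2 : (0 : ℤ) ∉ ({1} : Finset ℤ) := by decide
  simp only [Finset.sum_insert n1, Finset.sum_insert n2, Finset.sum_singleton]
  have u0 : besselI 1 0 / besselI 0 0 = 0 := by simp [besselI_zero_right]
  -- the nine sites of `[−1,1]²`: corners (supNorm 1, l1Norm 2), edge midpoints (1, 1), centre (0, 0)
  have hc1 : Site.supNorm (![-1, -1] : Site 2) = 1 ∧ ¬ l1Norm (![-1, -1] : Site 2) = 1 := by decide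
  have hc2 : Site.supNorm (![-1, 1] : Site 2) = 1 ∧ ¬ l1Norm (![-1, 1] : Site 2) = 1 := by decide
  have hc3 : Site.supNorm (![1, -1] : Site 2) = 1 ∧ ¬ l1Norm (![1, -1] : Site 2) = 1 := by decide
  have hc4 : Site.supNorm (![1, 1] : Site 2) = 1 ∧ ¬ l1Norm (![1, 1] : Site 2) = 1 := by decide
  have he1 : Site.supNorm (![-1, 0] : Site 2) = 1 ∧ l1Norm (![-1, 0] : Site 2) = 1 := by decide
  have he2 : Site.supNorm (![0, -1] : Site 2) = 1 ∧ l1Norm (![0, -1] : Site 2) = 1 := by decide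
  have he3 : Site.supNorm (![0, 1] : Site 2) = 1 ∧ l1Norm (![0, 1] : Site 2) = 1 := by decide
  have he4 : Site.supNorm (![1, 0] : Site 2) = 1 ∧ l1Norm (![1, 0] : Site 2) = 1 := by decide
  have h0 : ¬ Site.supNorm (![0, 0] : Site 2) = 1 := by decide
  rw [if_pos hc1.1, if_neg hc1.2, if_pos hc2.1, if_neg hc2.2, if_pos hc3.1, if_neg hc3.2, if_pos hc4.1,
    if_neg hc4.2, if_pos he1.1, if_pos he1.2, if_pos he2.1, if_pos he2.2, if_pos he3.1, if_pos he3.2,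
    if_pos he4.1, if_pos he4.2, if_neg h0, u0]
  ring

/-- **The interior susceptibility at `R = 1` is trivial**: `χ^{int}_1(K) = boxInteriorSum K 1 = 1` (the interior of
`[−1,1]²` is the centre alone, `⟨cos(θ_0 − θ_0)⟩ = 1`). Hence §1 at `R = 1` reads `4u(K₀) < 1`,
`βJ⊥ ≤ (1 − 4u(K₀))/4`, base `(1 + 4u(K₀))/2` — the star itself (`4u(βJ∥) + 2u(βJ⊥)`, §§2–3) is sharper, since
`2u(y) ≤ y`. [cite: Lieb1980, Theorem 4 and p. 128 (boxes)] -/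
theorem boxInteriorSum_one (K : ℝ) : boxInteriorSum K 1 = 1 := by
  classical
  unfold boxInteriorSum
  have hfilter : (Finset.univ : Finset (box 2 1)).filter (fun y : box 2 1 => Site.supNorm (y : Site 2) < 1) =
      {refCentre 2 1} := by
    ext y
    simp only [Finset.mem_filter, Finset.mem_univ, true_and, Finset.mem_singleton, Nat.lt_one_iff]
    constructor
    · intro h
      exact Subtype.ext (Site.supNorm_eq_zero_iff.1 h)
    · intro h
      rw [h]
      exact Site.supNorm_eq_zero_iff.2 rfl
  rw [hfilter, Finset.sum_singleton]
  exact twoPoint_self_eq_one _ _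

end RadiusOne

end PlaneRotator

end Literature.Probability.LatticeModels

end
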